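import Summits.AnomalousDissipation.AnomalousDissipation.Theorems.KolmogorovFloorEnsembleCeiling.Negative.PlanarSteady

/-!
# Negative knowledge for the crux `KolmogorovFloorEnsembleCeiling` (stmt-AnomalousDissipation-14183), II:
# planar forces carry no loud-and-bounded steady branch — the target's witness is genuinely three-dimensional

Crux `TaylorCertificates.KolmogorovFloorEnsembleCeiling` (route `AnomalousDissipation/TaylorCertificates`, rank 7;
cdisprove seat `refuter-cdisprove-stmt-AnomalousDissipation-14183-0`, 2026-08-16) couples, for ONE force `f`, a
dissipation FLOOR certificate with the ensemble energy CEILING. Part I (`Negative/SameForce.lean`) shows that the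
two together make every steady state of `NS_ν(f)`, `ν < ν₀`, LOUD (`ν‖∇u‖² ≥ ε₀`) AND BOUNDED (`‖u‖² ≤ E`).
This file proves that NO PLANAR FORCE `f = (g₁, g₂, 0)(x₁, x₂)` has that property, and draws the consequences
for the route: the `∀ ν`-bodies of the target `X = FloorCertificateEnsembleCeiling` (rank 0), of crux #3
`SteadyStatesLoudBounded`, of crux #7 (the pair) are all FALSE at every planar force. Kernel-checked form of
the route header's barrier remark "evaded only by a genuinely three-dimensional `f`" — by a route through
steady states that is cheaper than the Alexakis–Doering barrier it cites (no time-dependent 2-D theory).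

## The mechanism (`not_loudBounded_planar`)

Fix `g : T² → ℝ²` smooth and mean-zero and `ν > 0`. Temam's theorem on `T²` (existence in `V`,
`Temam1979_exists_steadyWeakSolution_holds`; regularity, `Temam1979_steadyWeakSolution_smooth_holds`) gives a
smooth solenoidal mean-zero `v` whose steady residual `R = νΔv − (v·∇)v + g` is `L²`-orthogonal to `𝒱(T²)`
(`residual_orthogonal_of_steadyWeak`) and mean zero, hence a gradient `∇φ` (smooth Helmholtz decomposition,
`smooth_helmholtz_holds`; `exists_eq_gradient_of_orthogonal`). Two consequences:
* LIFT (`planarLift_classical_steady`): `u = (v, 0)∘π` is a smooth classical steady state of `NS_ν((g,0)∘π)` on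
  `T³` — its residual is `(∇φ, 0)∘π = ∇(φ∘π)`, orthogonal to solenoidal fields (`TorusPlanarLift` calculus:
  `laplacian_twoHalf`, `convect_twoHalf`, `fderiv_comp_planarProj`; transport identity); and
  `‖∇u‖²_{T³} = ‖∇v‖²_{T²}`, `‖u‖²_{T³} = ‖v‖²_{T²}` (`measurePreserving_planarProj`).
* SQUEEZE (`dissipation_sq_le_of_residual_gradient`): pairing `R = ∇φ` with the solenoidal field `Δv` gives
  `0 = ν‖Δv‖² − ((v·∇)v, Δv) + (g, Δv)` and the middle term VANISHES ON `T²` (no vortex stretching, FMRT (A.62),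
  `integral_inner_laplacian_convect_self_eq_zero`); so `ν‖Δv‖² = −(Δg, v) ≤ ‖Δg‖₂‖v‖₂`, and with
  `‖∇v‖² = −(v, Δv) ≤ ‖v‖₂‖Δv‖₂`: `(ν‖∇v‖²)² ≤ ν ‖Δg‖₂ ‖v‖₂³`.
If every smooth classical steady state at every `ν < ν₀` were `ε₀`-loud and `E`-bounded, then at
`ν = min(ν₀/2, ε₀²/(‖Δg‖₂ E'√E' + 1))`, `E' = max E 0`: `ε₀² ≤ (ν‖∇v‖²)² ≤ ν‖Δg‖₂E'√E' < ε₀²`. ∎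
Neither half alone dies this way (planar steady states may be loud-and-fat: Kolmogorov's laminar state); it is
the INTERSECTION floor ∩ ceiling that is empty on planar forces.

## Contents (residuals, Helmholtz reduction and the lift calculus are in `Negative/PlanarSteady.lean`)
* §1 `dissipation_sq_le_of_residual_gradient` (the 2-D squeeze);
* §2 `LoudBoundedSteadyAt` (= the `∀ ν`-body of route item #3), `exists_planar_steady_squeezed`,
  `not_loudBounded_planar`, `not_steadyStatesLoudBounded_planar`;
* §3 `exists_steadyState_of_classical`, `loudBoundedSteadyAt_of_floor_ceiling` (floor family + ceiling ⇒ #3-body,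
  same force), `not_floor_ceiling_planar`, `not_targetBody_planar` (X's `∀ ν`-body at a planar force is false).
Nothing here asserts a Theses statement. Axioms: `propext`, `Classical.choice`, `Quot.sound`.
-/

noncomputable section

set_option linter.dupNamespace false

open MeasureTheory UnitAddTorus
open scoped InnerProductSpace ENNReal

namespace Summit.AnomalousDissipation.AnomalousDissipation.Theorems.KolmogorovFloorEnsembleCeiling.Negative

open Literature.Analysis.FunctionSpaces Literature.Analysis.FunctionSpaces.Torus Literature.Analysis.FluidPDE
open Summit.AnomalousDissipation.AnomalousDissipation.Theses.TaylorCertificates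

local notation "𝕋³" => UnitAddTorus (Fin 3)
local notation "𝕋²" => UnitAddTorus (Fin 2)
local notation "E³" => EuclideanSpace ℝ (Fin 3)
local notation "E²" => EuclideanSpace ℝ (Fin 2)

/-! ## §1 The two-dimensional enstrophy squeeze for smooth steady states -/

section TwoD

/-- Cauchy–Schwarz on the torus (re-export of the barrier-catalogue helper, continuous fields). -/
theorem abs_integral_inner_le {d : Type} [Fintype d] {F w : UnitAddTorus d → EuclideanSpace ℝ d}
    (hF : Continuous F) (hw : Continuous w) :
    |∫ x, ⟪F x, w x⟫_ℝ| ≤ Real.sqrt (∫ x, ‖F x‖ ^ 2) * Real.sqrt (∫ x, ‖w x‖ ^ 2) :=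
  Literature.Barriers.AnomalousDissipation.Torus.abs_integral_inner_le_sqrt_mul_sqrt hF hw

/-- `‖∇v‖₂² = −∫⟪v, Δv⟫` for smooth fields (Green's first identity). -/
theorem gradNormSq_eq_neg_integral_inner_laplacian {d : Type} [Fintype d] [DecidableEq d]
    {v : UnitAddTorus d → EuclideanSpace ℝ d} (hv : IsSmooth v) :
    gradNormSq v = -∫ x, ⟪v x, Torus.laplacian v x⟫_ℝ := by
  unfold gradNormSq
  rw [integral_finsetSum _ (fun i _ => ((hv.partialDeriv i).norm_sq).integrable)]
  have h := Torus.sum_integral_inner_partialDeriv_eq_neg_integral_inner_laplacian hv hv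
  simp_rw [real_inner_self_eq_norm_sq] at h
  exact h

/-- **The 2-D squeeze.** Let `v` be a smooth solenoidal field on `T²`, `g` smooth, `ν ≥ 0`, and suppose
the steady residual `R = νΔv − (v·∇)v + g` is a gradient. Then
`(ν‖∇v‖²)² ≤ ν · ‖Δg‖₂ · ‖v‖₂² · ‖v‖₂`.
Proof: pair `R = ∇φ` with the solenoidal field `Δv` — the left side vanishes; on `T²` the trilinear
term `((v·∇)v, Δv)` vanishes (no vortex stretching, FMRT (A.62)); so `ν‖Δv‖² = −(g, Δv) = −(Δg, v)
≤ ‖Δg‖₂‖v‖₂`, while `‖∇v‖² = −(v, Δv) ≤ ‖v‖₂‖Δv‖₂`. -/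
theorem dissipation_sq_le_of_residual_gradient {ν : ℝ} (hν : 0 ≤ ν) {g v : 𝕋² → E²} (hg : IsSmooth g)
    (hv : IsSmooth v) (hdiv : IsDivFree v)
    (hR : ∃ φ : 𝕋² → ℝ, IsSmooth φ ∧ ∀ x, steadyResidual ν g v x = Torus.gradient φ x) :
    (ν * gradNormSq v) ^ 2 ≤
      ν * Real.sqrt (∫ x, ‖Torus.laplacian g x‖ ^ 2) * ((∫ x, ‖v x‖ ^ 2) * Real.sqrt (∫ x, ‖v x‖ ^ 2)) := by
  obtain ⟨φ, hφ, hRφ⟩ := hR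
  have hΔs : IsSmooth (Torus.laplacian v) := hv.laplacian
  have hΔdiv : IsDivFree (Torus.laplacian v) := Torus.IsDivFree.laplacian_of_isSmooth hv hdiv
  -- (a) `∫⟪R, Δv⟫ = 0`
  have h0 : ∫ x, ⟪steadyResidual ν g v x, Torus.laplacian v x⟫_ℝ = 0 := by
    simp_rw [hRφ]
    exact integral_inner_gradient_eq_zero_of_isDivFree hΔs hφ hΔdiv
  -- the 2-D orthogonality
  have horth : ∫ x, ⟪Torus.convect v v x, Torus.laplacian v x⟫_ℝ = 0 := by
    rw [← Torus.integral_inner_laplacian_convect_self_eq_zero hv hdiv]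
    exact integral_congr_ae (ae_of_all _ fun x => real_inner_comm _ _)
  -- expand `∫⟪R, Δv⟫`
  have i1 : Integrable (fun x => ⟪ν • Torus.laplacian v x, Torus.laplacian v x⟫_ℝ) volume := by
    have := ((hΔs.inner hΔs).integrable).const_mul ν
    refine this.congr (ae_of_all _ fun x => ?_)
    simp [real_inner_smul_left]
  have i2 : Integrable (fun x => ⟪Torus.convect v v x, Torus.laplacian v x⟫_ℝ) volume :=
    ((hv.convect hv).inner hΔs).integrable
  have i3 : Integrable (fun x => ⟪g x, Torus.laplacian v x⟫_ℝ) volume := (hg.inner hΔs).integrable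
  have hexp : ∫ x, ⟪steadyResidual ν g v x, Torus.laplacian v x⟫_ℝ =
      ν * (∫ x, ‖Torus.laplacian v x‖ ^ 2) + ∫ x, ⟪g x, Torus.laplacian v x⟫_ℝ := by
    unfold steadyResidual
    simp_rw [inner_add_left, inner_sub_left]
    rw [integral_add ?_ i3, integral_sub i1 i2, horth, sub_zero]
    · congr 1
      rw [← integral_const_mul]
      refine integral_congr_ae (ae_of_all _ fun x => ?_)
      simp only [real_inner_smul_left, real_inner_self_eq_norm_sq]
    · exact i1.sub i2
  rw [hexp] at h0
  -- (b) `ν ‖Δv‖² ≤ ‖Δg‖ ‖v‖`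
  set L : ℝ := ∫ x, ‖Torus.laplacian v x‖ ^ 2 with hL
  set Ev : ℝ := ∫ x, ‖v x‖ ^ 2 with hEv
  set G : ℝ := Real.sqrt (∫ x, ‖Torus.laplacian g x‖ ^ 2) with hG
  have hL0 : 0 ≤ L := integral_nonneg fun x => sq_nonneg _
  have hEv0 : 0 ≤ Ev := integral_nonneg fun x => sq_nonneg _
  have hG0 : 0 ≤ G := Real.sqrt_nonneg _
  have hgΔ : ∫ x, ⟪g x, Torus.laplacian v x⟫_ℝ = ∫ x, ⟪Torus.laplacian g x, v x⟫_ℝ :=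
    (Torus.integral_inner_laplacian_comm hg hv).symm
  have hb : ν * L ≤ G * Real.sqrt Ev := by
    have h1 : ν * L = -∫ x, ⟪Torus.laplacian g x, v x⟫_ℝ := by linarith [hgΔ]
    have h2 := abs_integral_inner_le hg.laplacian.continuous hv.continuous
    rw [h1]
    exact (neg_le_abs _).trans h2
  -- (c) `‖∇v‖² ≤ ‖v‖ ‖Δv‖`
  have hc : gradNormSq v ≤ Real.sqrt Ev * Real.sqrt L := by
    rw [gradNormSq_eq_neg_integral_inner_laplacian hv]
    exact (neg_le_abs _).trans (abs_integral_inner_le hv.continuous hΔs.continuous)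
  -- (d) combine
  have hgrad0 : 0 ≤ gradNormSq v := gradNormSq_nonneg v
  have hc2 : gradNormSq v ^ 2 ≤ Ev * L := by
    have := pow_le_pow_left₀ hgrad0 hc 2
    rwa [mul_pow, Real.sq_sqrt hEv0, Real.sq_sqrt hL0] at this
  calc (ν * gradNormSq v) ^ 2 = ν * (ν * gradNormSq v ^ 2) := by ring
    _ ≤ ν * (ν * (Ev * L)) := mul_le_mul_of_nonneg_left (mul_le_mul_of_nonneg_left hc2 hν) hν
    _ = ν * (Ev * (ν * L)) := by ring
    _ ≤ ν * (Ev * (G * Real.sqrt Ev)) :=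
        mul_le_mul_of_nonneg_left (mul_le_mul_of_nonneg_left hb hEv0) hν
    _ = ν * G * (Ev * Real.sqrt Ev) := by ring

end TwoD

/-! ## §2 Planar forces: no loud-and-bounded steady branch -/

section Planar

/-- ALL smooth classical steady states of `NS_ν(f)` are `ε₀`-loud and `E`-bounded — verbatim the inner block
of route item #3 `SteadyStatesLoudBounded` at one viscosity. -/
def LoudBoundedSteadyAt (f : 𝕋³ → E³) (ε₀ E ν : ℝ) : Prop :=
  ∀ u : 𝕋³ → E³, IsSmooth u → IsDivFree u → HasZeroMean u →
    (∀ w : 𝕋³ → E³, IsSmooth w → IsDivFree w → HasZeroMean w →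
      ∫ x, ⟪ν • Torus.laplacian u x - Torus.convect u u x + f x, w x⟫_ℝ = 0) →
    ε₀ ≤ ν * gradNormSq u ∧ ∫ x, ‖u x‖ ^ 2 ≤ E

/-- **At every viscosity a planar force carries a planar steady state whose dissipation is squeezed by its
energy**: for `g` smooth solenoidal mean-zero on `T²` and `ν > 0` there is a smooth solenoidal mean-zero
`v` on `T²` whose planar lift `(v, 0)` is a classical steady state of `NS_ν((g, 0))` on `T³`, with
`(ν‖∇v‖²)² ≤ ν‖Δg‖₂‖v‖₂³` and `‖∇(v,0)‖² = ‖∇v‖²`, `‖(v,0)‖₂² = ‖v‖₂²` (Temam's existence and regularity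
on `T²`, the smooth Helmholtz decomposition of the residual, the 2-D enstrophy orthogonality). -/
theorem exists_planar_steady_squeezed {g : 𝕋² → E²} (hg : IsSmooth g) (hgm : HasZeroMean g)
    {ν : ℝ} (hν : 0 < ν) :
    ∃ v : 𝕋² → E², IsSmooth v ∧ IsDivFree v ∧ HasZeroMean v ∧
      (∀ W : 𝕋³ → E³, IsSmooth W → IsDivFree W → HasZeroMean W →
        ∫ x, ⟪ν • Torus.laplacian (planarLift v) x - Torus.convect (planarLift v) (planarLift v) x +
          planarLift g x, W x⟫_ℝ = 0) ∧
      (ν * gradNormSq v) ^ 2 ≤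
        ν * Real.sqrt (∫ x, ‖Torus.laplacian g x‖ ^ 2) * ((∫ x, ‖v x‖ ^ 2) * Real.sqrt (∫ x, ‖v x‖ ^ 2)) := by
  -- Temam on `T²`: existence in `V`, smoothness
  obtain ⟨u₂, hV, hsteady⟩ := Torus.Temam1979_exists_steadyWeakSolution_holds (d := Fin 2) (by simp) hν (hg.memLp 2)
  obtain ⟨v, hv, hae⟩ := Torus.Temam1979_steadyWeakSolution_smooth_holds (d := Fin 2) (by simp) hν hg hV hsteady
  obtain ⟨hdiv, hmean⟩ := divFree_meanZero_of_rep hv hae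
  -- the residual is a gradient
  have horth := residual_orthogonal_of_steadyWeak hg hsteady hv hae
  have hR := exists_eq_gradient_of_orthogonal (isSmooth_steadyResidual ν hg hv)
    (hasZeroMean_steadyResidual ν hg hgm hv hdiv) horth
  obtain ⟨φ, hφ, hRφ⟩ := hR
  exact ⟨v, hv, hdiv, hmean, planarLift_classical_steady hv hφ hRφ,
    dissipation_sq_le_of_residual_gradient hν.le hg hv hdiv ⟨φ, hφ, hRφ⟩⟩

/-- **PLANAR FORCES CARRY NO UNIFORMLY LOUD-AND-BOUNDED STEADY BRANCH.** For `f = (g₁, g₂, 0)(x₁, x₂)` with `g`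
smooth solenoidal mean-zero on `T²`, no `ε₀ > 0`, `E`, `ν₀ > 0` make every smooth classical steady state of
`NS_ν(f)`, `ν < ν₀`, simultaneously `ε₀`-loud and `E`-bounded: at `ν = min(ν₀/2, ε₀²/(‖Δg‖₂ E'√E' + 1))`,
`E' = max E 0`, the planar steady state of `exists_planar_steady_squeezed` would have
`ε₀² ≤ (ν‖∇v‖²)² ≤ ν‖Δg‖₂E'√E' < ε₀²`. -/
theorem not_loudBounded_planar {g : 𝕋² → E²} (hg : IsSmooth g) (hgm : HasZeroMean g)
    {ε₀ E ν₀ : ℝ} (hε₀ : 0 < ε₀) (hν₀ : 0 < ν₀)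
    (h : ∀ ν : ℝ, 0 < ν → ν < ν₀ → LoudBoundedSteadyAt (planarLift g) ε₀ E ν) : False := by
  set G : ℝ := Real.sqrt (∫ x, ‖Torus.laplacian g x‖ ^ 2) with hG
  set E' : ℝ := max E 0 with hE'
  have hG0 : 0 ≤ G := Real.sqrt_nonneg _
  have hE'0 : 0 ≤ E' := le_max_right _ _
  have hK : 0 < G * (E' * Real.sqrt E') + 1 := by positivity
  set ν : ℝ := min (ν₀ / 2) (ε₀ ^ 2 / (G * (E' * Real.sqrt E') + 1)) with hνdef
  have hν : 0 < ν := lt_min (half_pos hν₀) (div_pos (pow_pos hε₀ 2) hK)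
  have hνν₀ : ν < ν₀ := (min_le_left _ _).trans_lt (half_lt_self hν₀)
  have hνK : ν * (G * (E' * Real.sqrt E') + 1) ≤ ε₀ ^ 2 := by
    have : ν ≤ ε₀ ^ 2 / (G * (E' * Real.sqrt E') + 1) := min_le_right _ _
    rwa [le_div_iff₀ hK] at this
  obtain ⟨v, hv, hdiv, hmean, hsteady, hsq⟩ := exists_planar_steady_squeezed hg hgm hν
  obtain ⟨hloud, hbdd⟩ := h ν hν hνν₀ (planarLift v) (isSmooth_planarLift hv) (isDivFree_planarLift hdiv)
    (hasZeroMean_planarLift hv hmean) hsteady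
  rw [gradNormSq_planarLift hv] at hloud
  rw [integral_norm_sq_planarLift hv.continuous] at hbdd
  set Ev : ℝ := ∫ x, ‖v x‖ ^ 2 with hEv
  have hEv0 : 0 ≤ Ev := integral_nonneg fun x => sq_nonneg _
  have hEvE' : Ev ≤ E' := hbdd.trans (le_max_left _ _)
  have h1 : ε₀ ^ 2 ≤ (ν * gradNormSq v) ^ 2 := pow_le_pow_left₀ hε₀.le hloud 2
  have h2 : Ev * Real.sqrt Ev ≤ E' * Real.sqrt E' :=
    mul_le_mul hEvE' (Real.sqrt_le_sqrt hEvE') (Real.sqrt_nonneg _) hE'0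
  have h3 : (ν * gradNormSq v) ^ 2 ≤ ν * G * (E' * Real.sqrt E') :=
    hsq.trans (mul_le_mul_of_nonneg_left h2 (mul_nonneg hν.le hG0))
  have h4 : ν * G * (E' * Real.sqrt E') < ε₀ ^ 2 := by
    have : ν * G * (E' * Real.sqrt E') = ν * (G * (E' * Real.sqrt E') + 1) - ν := by ring
    rw [this]
    linarith
  linarith

/-- Planar lifts of admissible planar forces are admissible forces on `T³`. -/
theorem planarLift_admissible {g : 𝕋² → E²} (hg : IsSmooth g) (hgd : IsDivFree g) (hgm : HasZeroMean g) :
    IsSmooth (planarLift g) ∧ IsDivFree (planarLift g) ∧ HasZeroMean (planarLift g) :=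
  ⟨isSmooth_planarLift hg, isDivFree_planarLift hgd, hasZeroMean_planarLift hg hgm⟩

/-- **No planar witness of route item #3 `SteadyStatesLoudBounded`** (its inner block, for the planar force
`(g, 0)`). -/
theorem not_steadyStatesLoudBounded_planar {g : 𝕋² → E²} (hg : IsSmooth g) (hgm : HasZeroMean g) :
    ¬ ∃ (ε₀ E ν₀ : ℝ), 0 < ε₀ ∧ 0 < ν₀ ∧ ∀ ν : ℝ, 0 < ν → ν < ν₀ → LoudBoundedSteadyAt (planarLift g) ε₀ E ν := by
  rintro ⟨ε₀, E, ν₀, hε₀, hν₀, h⟩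
  exact not_loudBounded_planar hg hgm hε₀ hν₀ h

end Planar

/-! ## §3 Consequences for the route's statements (floor + ceiling ⇒ loud-and-bounded; no planar witnesses) -/

section Route

open Summit.AnomalousDissipation.AnomalousDissipation.Theorems.TaylorCertificatePair.Negative
open Summit.AnomalousDissipation.AnomalousDissipation.Theorems.FloorCertificate.Negative
open Summit.AnomalousDissipation.AnomalousDissipation.Theorems.EnsembleCeiling.Negative

/-- A smooth solenoidal mean-zero field that solves the steady Navier–Stokes equations in the classical weak
sense of route item #3 (`∫ ⟪νΔu − (u·∇)u + f, w⟫ = 0` for all `w ∈ 𝒱`) is carried by a state `U ∈ V` of `H`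
which is a steady weak solution in the sense of `Torus.IsSteadyWeakSolution` (all derivatives moved onto the
test field: Green's second identity and the antisymmetry of the trilinear form). -/
theorem exists_steadyState_of_classical {ν : ℝ} {f u : 𝕋³ → E³}
    (hf : IsSmooth f) (hu : IsSmooth u) (hdiv : IsDivFree u) (hmean : HasZeroMean u)
    (hsteady : ∀ w : 𝕋³ → E³, IsSmooth w → IsDivFree w → HasZeroMean w →
      ∫ x, ⟪ν • Torus.laplacian u x - Torus.convect u u x + f x, w x⟫_ℝ = 0) :
    ∃ U : Torus.energySpace (Fin 3),
      ((U : Lp E³ 2 (volume : Measure 𝕋³)) : 𝕋³ → E³) =ᵐ[volume] u ∧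
      (U : Lp E³ 2 (volume : Measure 𝕋³)) ∈ Torus.energySpaceV (Fin 3) ∧
      Torus.IsSteadyWeakSolution ν f U := by
  obtain ⟨U, hU⟩ := exists_state_of_smooth hu hdiv hmean
  have hV : (U : Lp E³ 2 (volume : Measure 𝕋³)) ∈ Torus.energySpaceV (Fin 3) :=
    Torus.smoothSolenoidal_subset_energySpaceV_holds ⟨u, hu, hdiv, hmean, hU⟩
  refine ⟨U, hU, hV, fun w hw hdw hzw => ?_⟩
  rw [nsGeneratorPairing_of_ae_rep hU, ← integral_inner_steadyResidual ν hf hu hdiv hw]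
  exact hsteady w hw hdw hzw

/-- **Floor family + ensemble ceiling at one viscosity ⇒ every smooth classical steady state is loud AND
bounded** (Dirac case of weak duality for the floor; the Dirac mass at a steady state for the ceiling). This is
the bridge from the target `X = FloorCertificateEnsembleCeiling` and from the pair (crux #7) to route item #3,
for the SAME force. -/
theorem loudBoundedSteadyAt_of_floor_ceiling {f : 𝕋³ → E³} (hf : IsSmooth f) {ε₀ E ν : ℝ} (hν : 0 < ν)
    (hfl : FloorFamily f ε₀ ν)
    (hceil : ∀ μ : Measure (Torus.energySpace (Fin 3)), Torus.IsStationaryStatisticalSolution ν f μ →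
      Integrable (fun v : Torus.energySpace (Fin 3) => ‖v‖ ^ 2) μ → Torus.ensembleEnergy μ ≤ E) :
    LoudBoundedSteadyAt f ε₀ E ν := by
  intro u hu hdiv hmean hsteady
  obtain ⟨U, hU, hV, hUsteady⟩ := exists_steadyState_of_classical hf hu hdiv hmean hsteady
  have hf2 : MemLp f 2 volume := hf.memLp 2
  have hloud := floorFamily_le_dissipation_of_steady hν hf2 hfl hV hUsteady
  have hbdd := norm_sq_le_of_ceiling hν hf2 hceil hV hUsteady
  rw [eGradNormSq_congr_ae' hU, ← Torus.gradNormSq_eq_toReal_eGradNormSq_holds hu] at hloud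
  rw [norm_sq_of_ae hU] at hbdd
  exact ⟨hloud, hbdd⟩

/-- **NO PLANAR WITNESS OF THE TARGET (nor of the pair): the witness force of `X = FloorCertificateEnsembleCeiling`
is genuinely three-dimensional.** For `f = (g₁, g₂, 0)(x₁, x₂)` (`g` smooth and mean-zero on `T²`; solenoidality
is not even needed) there are no `ε₀ > 0`, `E`, `ν₀ > 0` such that at every `ν ∈ (0, ν₀)` a floor family
(any cylindrical `Φ₁`, any `θ₁ ≤ 0` — the unrestricted class of `X` and of crux #5, a fortiori the Kolmogorov class
of cruxes #2/#7) AND the ensemble ceiling hold. This is `X`'s `∀ ν`-body verbatim (`floorCertificate_iff`-style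
definitional unbundling), so `X`'s witness, if any, is not planar. Mechanism: both halves together make every steady
state loud and bounded (`loudBoundedSteadyAt_of_floor_ceiling`), which planar forces forbid (`not_loudBounded_planar`:
the 2-D steady enstrophy squeeze `(ν‖∇v‖²)² ≤ ν‖Δg‖₂‖v‖₂³`). The Alexakis–Doering barrier
(`Literature.Barriers.AnomalousDissipation.AlexakisDoering2006_energyDissipationBound`, time-dependent 2-D flows)
predicted this; the present route is through steady states only. -/
theorem not_floor_ceiling_planar {g : 𝕋² → E²} (hg : IsSmooth g) (hgm : HasZeroMean g) :
    ¬ ∃ (ε₀ E ν₀ : ℝ), 0 < ε₀ ∧ 0 < ν₀ ∧ ∀ ν : ℝ, 0 < ν → ν < ν₀ →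
      FloorFamily (planarLift g) ε₀ ν ∧
      (∀ μ : Measure (Torus.energySpace (Fin 3)), Torus.IsStationaryStatisticalSolution ν (planarLift g) μ →
        Integrable (fun v : Torus.energySpace (Fin 3) => ‖v‖ ^ 2) μ → Torus.ensembleEnergy μ ≤ E) := by
  rintro ⟨ε₀, E, ν₀, hε₀, hν₀, h⟩
  exact not_loudBounded_planar hg hgm hε₀ hν₀ fun ν hν hνν₀ =>
    loudBoundedSteadyAt_of_floor_ceiling (isSmooth_planarLift hg) hν (h ν hν hνν₀).1 (h ν hν hνν₀).2

/-- The same, with the floor written out as in the Theses file (the `∀ ν`-body of `FloorCertificateEnsembleCeiling`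
at the force `planarLift g`, character for character up to the name of the force). -/
theorem not_targetBody_planar {g : 𝕋² → E²} (hg : IsSmooth g) (hgm : HasZeroMean g) :
    ¬ ∃ (ε₀ E ν₀ : ℝ), 0 < ε₀ ∧ 0 < ν₀ ∧ ∀ ν : ℝ, 0 < ν → ν < ν₀ → (∃ (Φ₁ : Literature.Analysis.FluidPDE.Torus.CylindricalTest (Fin 3)) (θ₁ : ℝ), θ₁ ≤ 0 ∧ ∀ u : Literature.Analysis.FunctionSpaces.Torus.energySpace (Fin 3), let uf : UnitAddTorus (Fin 3) → EuclideanSpace ℝ (Fin 3) := ((u : MeasureTheory.Lp (EuclideanSpace ℝ (Fin 3)) 2 (MeasureTheory.volume : MeasureTheory.Measure (UnitAddTorus (Fin 3)))) : UnitAddTorus (Fin 3) → EuclideanSpace ℝ (Fin 3)); let D : ℝ := ν * (Literature.Analysis.FunctionSpaces.Torus.eGradNormSq uf).toReal; let P : ℝ := Literature.Analysis.FluidPDE.Torus.pairing (u : MeasureTheory.Lp (EuclideanSpace ℝ (Fin 3)) 2 (MeasureTheory.volume : MeasureTheory.Measure (UnitAddTorus (Fin 3)))) (planarLift g) - D; Literature.Analysis.FunctionSpaces.Torus.eGradNormSq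 uf ≠ ⊤ → ‖u‖ ^ 2 ≤ 16 * (∫ x, ‖(planarLift g) x‖ ^ 2) / ν ^ 2 → ε₀ ≤ D + Literature.Analysis.FluidPDE.Torus.nsGeneratorPairing ν (planarLift g) u (Φ₁.grad u) + 2 * θ₁ * P) ∧ (∀ μ : MeasureTheory.Measure (Literature.Analysis.FunctionSpaces.Torus.energySpace (Fin 3)), Literature.Analysis.FluidPDE.Torus.IsStationaryStatisticalSolution ν (planarLift g) μ → MeasureTheory.Integrable (fun v : Literature.Analysis.FunctionSpaces.Torus.energySpace (Fin 3) => ‖v‖ ^ 2) μ → Literature.Analysis.FluidPDE.Torus.ensembleEnergy μ ≤ E) :=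
  not_floor_ceiling_planar hg hgm

end Route

end Summit.AnomalousDissipation.AnomalousDissipation.Theorems.KolmogorovFloorEnsembleCeiling.Negative
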